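import Literature.NumberTheory.Sieve.SmoothMinorArcs
import Literature.NumberTheory.Sieve.SmoothCountSaddle
import HarnessLib

/-!
# Harper's Theorem 1 at all scales `√x ≤ x' ≤ x` with the saddle point of `x`

Topic `Literature/NumberTheory/Sieve`; a PROVED file toward
`Literature.NumberTheory.DiophantineGeometry.XYZUpperHalf` ([Harper2016, Cor. 1]). In the
restriction argument (op. cit. §4, proof of Proposition 3) Theorem 1 is applied to sums over
`M < m ≤ 2M` at many scales `M ∈ (x/yK, x/K]`, and the resulting `Ψ(2M, y)` are compared with
`Ψ(x, y)` by Smooth Numbers Result 2. We package this: `norm_smoothExpSum_le_scaled` — for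
`x ≥ x₀`, `(log x)^4 ≤ y`, `log y ≤ ½ (log x)^{1/6}`, `√x ≤ x' ≤ x`, `(a, q) = 1`, `L' = 2(1+|δ|x')`,
`q² L'² y³ ≤ x'`:
`|∑_{n ≤ x', n ∈ S(y)} e(n(a/q+δ))| ≤ C (log x)³ y^{(5/2)(1−α)} (qL')^{−1/2+(3/2)(1−α)} x'^α ζ(α,y)/√φ₂(α,y)`
with `α = α(x, y)` (Theorem 1 at `x'`, then `α(x', y) ≥ α(x, y)` (`saddlePoint_antitone`),
`x'^{α'} ζ̃(α') ≤ 50 Ψ(x', y)` (`card_smoothNumbersUpTo_two_sided`) and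
`Ψ(x', y) ≤ C x'^α ζ̃(α)` (`card_smoothNumbersUpTo_le_model_of_le`)).

## References

* A. J. Harper, Compositio Math. 152 (2016) 1121–1158, Theorem 1 and §4 [Harper2016].
-/

noncomputable section

open Finset Real
open scoped FourierTransform

namespace Literature.NumberTheory.Sieve

set_option maxHeartbeats 1600000 in
-- several constants and a long chain of inequalities
/-- **Theorem 1 at the scales `√x ≤ x' ≤ x`, with `α = α(x, y)`.** See the module docstring.
[cite: Harper2016, Theorem 1 and §4 (proof of Proposition 3)] -/
theorem norm_smoothExpSum_le_scaled :
    ∃ C x₀ : ℝ, 0 < C ∧ ∀ (x : ℝ) (y : ℕ), x₀ ≤ x → Real.log x ^ 4 ≤ y →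
      Real.log y ≤ 1 / 2 * Real.log x ^ (1 / 6 : ℝ) → ∀ x' : ℝ, x ^ (1 / 2 : ℝ) ≤ x' → x' ≤ x →
      ∀ (q : ℕ), 0 < q → ∀ (a : ℤ), IsCoprime a (q : ℤ) →
      ∀ (δ : ℝ), (q : ℝ) ^ 2 * (2 * (1 + |δ| * x')) ^ 2 * (y : ℝ) ^ 3 ≤ x' →
        ‖∑ n ∈ Nat.smoothNumbersUpTo ⌊x'⌋₊ (y + 1), (𝐞 ((n : ℝ) * ((a : ℝ) / q + δ)) : ℂ)‖ ≤
          C * Real.log x ^ 3 * (y : ℝ) ^ (5 / 2 * (1 - saddlePoint x y)) *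
            ((q : ℝ) * (2 * (1 + |δ| * x'))) ^ (-(1 / 2 : ℝ) + 3 / 2 * (1 - saddlePoint x y)) *
            (x' ^ saddlePoint x y *
              (smoothZeta (saddlePoint x y) y / Real.sqrt (saddlePhi₂ (saddlePoint x y) y))) := by
  classical
  obtain ⟨C_T, x₀T, hC_T, hT⟩ := norm_smoothExpSum_le
  obtain ⟨x₀B, hB⟩ := card_smoothNumbersUpTo_two_sided
  obtain ⟨C₂, x₀M, hC₂, hM⟩ := card_smoothNumbersUpTo_le_model_of_le
  -- thresholds: we need `x' ≥ x₀T, x₀B` whenever `x' ≥ √x`, i.e. `x ≥ x₀T², x₀B²`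
  set X : ℝ := max ((max (max x₀T 1) (max x₀B 1)) ^ (2 : ℕ)) (max x₀M (Real.exp 16)) with hXdef
  refine ⟨50 * C_T * C₂, X, by positivity,
    fun x y hx hy4 hy6 x' hx'lo hx'x q hq a hcop δ hH => ?_⟩
  have hx₀M : x₀M ≤ x := le_trans ((le_max_left _ _).trans (le_max_right _ _)) hx
  have hxe : Real.exp 16 ≤ x := le_trans ((le_max_right _ _).trans (le_max_right _ _)) hx
  have hsq : (max (max x₀T 1) (max x₀B 1)) ^ (2 : ℕ) ≤ x := le_trans (le_max_left _ _) hx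
  ------------------------------------------------------------------
  set Lx := Real.log x with hLx
  have hLx16 : 16 ≤ Lx := by
    have := Real.log_le_log (Real.exp_pos _) hxe; rwa [Real.log_exp] at this
  have hx16 : (16 : ℝ) ≤ x := by
    have h1 : (16 : ℝ) ≤ Real.exp 16 := by have := Real.add_one_le_exp (16 : ℝ); linarith
    exact h1.trans hxe
  have hx1 : 1 < x := by linarith
  have hx0 : 0 < x := by linarith
  have hLx1 : 1 ≤ Lx := by linarith
  -- `x' ≥ √x ≥ max thresholds`
  set X2 := x ^ (1 / 2 : ℝ) with hX2
  have hX2sq : X2 ^ (2 : ℕ) = x := by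
    rw [hX2, ← Real.rpow_natCast, ← Real.rpow_mul hx0.le]; norm_num
  have hX2ge : max (max x₀T 1) (max x₀B 1) ≤ X2 := by
    have h0 : 0 ≤ max (max x₀T 1) (max x₀B 1) := le_trans zero_le_one ((le_max_right _ _).trans (le_max_left _ _))
    exact le_of_pow_le_pow_left₀ (by norm_num) (by positivity) (hsq.trans_eq hX2sq.symm)
  have hx'T : x₀T ≤ x' := le_trans ((le_max_left _ _).trans ((le_max_left _ _).trans hX2ge)) hx'lo
  have hx'B : x₀B ≤ x' := le_trans ((le_max_left _ _).trans ((le_max_right _ _).trans hX2ge)) hx'lo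
  have hx'1 : 1 ≤ x' := le_trans ((le_max_right _ _).trans ((le_max_left _ _).trans hX2ge)) hx'lo
  have hX2_0 : 0 < X2 := by positivity
  have hx'0 : 0 < x' := by linarith
  -- `log x' ≥ (log x)/2`
  have hlogx' : Lx / 2 ≤ Real.log x' := by
    have h1 : Real.log X2 = Lx / 2 := by rw [hX2, Real.log_rpow hx0, hLx]; ring
    rw [← h1]; exact Real.log_le_log hX2_0 hx'lo
  have hlogx'le : Real.log x' ≤ Lx := by rw [hLx]; exact Real.log_le_log hx'0 hx'x
  have hlogx'1 : 1 ≤ Real.log x' := by linarith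
  have hlogx'0 : 0 < Real.log x' := by linarith
  -- the hypotheses of Theorem 1 and of B11 at `x'`
  have hy4' : Real.log x' ^ 4 ≤ y := le_trans (pow_le_pow_left₀ hlogx'0.le hlogx'le 4) hy4
  have hhalf : (1 / 2 : ℝ) ≤ (1 / 2 : ℝ) ^ (1 / 6 : ℝ) := by
    have : (1 / 2 : ℝ) ^ (1 : ℝ) ≤ (1 / 2 : ℝ) ^ (1 / 6 : ℝ) :=
      Real.rpow_le_rpow_of_exponent_ge (by norm_num) (by norm_num) (by norm_num)
    rwa [Real.rpow_one] at this
  have hy6' : Real.log y ≤ Real.log x' ^ (1 / 6 : ℝ) := by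
    calc Real.log y ≤ 1 / 2 * Lx ^ (1 / 6 : ℝ) := hy6
      _ ≤ (1 / 2 : ℝ) ^ (1 / 6 : ℝ) * Lx ^ (1 / 6 : ℝ) := by gcongr
      _ = (Lx / 2) ^ (1 / 6 : ℝ) := by
          rw [← Real.mul_rpow (by norm_num) (by linarith)]; ring_nf
      _ ≤ Real.log x' ^ (1 / 6 : ℝ) := Real.rpow_le_rpow (by linarith) hlogx' (by norm_num)
  have hy5' : Real.log y ≤ Real.log x' ^ (1 / 5 : ℝ) :=
    hy6'.trans (Real.rpow_le_rpow_of_exponent_le hlogx'1 (by norm_num))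
  have hy16 : (16 : ℝ) ≤ y := by
    have : Lx ≤ y := by
      calc Lx = Lx ^ 1 := (pow_one _).symm
        _ ≤ Lx ^ 4 := pow_le_pow_right₀ hLx1 (by norm_num)
        _ ≤ y := hy4
    linarith
  have hy2 : 2 ≤ y := by exact_mod_cast (show (2 : ℝ) ≤ y by linarith)
  have hy1 : (1 : ℝ) ≤ y := by linarith
  -- the three inputs
  have h1 := hT x' y hx'T hy4' hy6' q hq a hcop δ hH
  obtain ⟨hBlo, -⟩ := hB x' y hx'B hy4' hy5'
  have h3 := hM x y hx₀M hy4 (by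
    refine hy6.trans ?_
    have : 0 ≤ Lx ^ (1 / 6 : ℝ) := by positivity
    linarith) x' hx'1 hx'x
  ------------------------------------------------------------------
  set α := saddlePoint x y with hαdef
  set α' := saddlePoint x' y with hα'def
  have hx'gt1 : 1 < x' := lt_of_lt_of_le (by rw [hX2]; exact Real.one_lt_rpow hx1 (by norm_num)) hx'lo
  have hαα' : α ≤ α' := by
    rw [hαdef, hα'def]; exact saddlePoint_antitone hx'gt1 hx'x hy2
  have hy0 : (0 : ℝ) < y := by linarith
  have hq1 : (1 : ℝ) ≤ q := by exact_mod_cast hq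
  set L' := 2 * (1 + |δ| * x') with hL'
  have hL'2 : 2 ≤ L' := by
    have h0 : 0 ≤ |δ| * x' := by positivity
    rw [hL']; linarith
  have hqL1 : (1 : ℝ) ≤ q * L' := by nlinarith
  set e : ℝ := -(1 / 2 : ℝ) + 3 / 2 * (1 - α) with he
  set e' : ℝ := -(1 / 2 : ℝ) + 3 / 2 * (1 - α') with he'
  have hee' : e' ≤ e := by rw [he, he']; linarith
  set ζt := smoothZeta α y / Real.sqrt (saddlePhi₂ α y) with hζt
  set ζt' := smoothZeta α' y / Real.sqrt (saddlePhi₂ α' y) with hζt'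
  have hα0 : 0 < α := by rw [hαdef]; exact saddlePoint_pos hx1 hy2
  have hα'0 : 0 < α' := by rw [hα'def]; exact saddlePoint_pos hx'gt1 hy2
  have hζt0 : 0 ≤ ζt := div_nonneg (smoothZeta_pos hα0).le (Real.sqrt_nonneg _)
  -- `x'^{α'} ζ̃' ≤ 50 C₂ x'^α ζ̃`
  have hmodel : x' ^ α' * ζt' ≤ 50 * C₂ * (x' ^ α * ζt) := by
    have h1' : x' ^ α' * smoothZeta α' y / Real.sqrt (saddlePhi₂ α' y) ≤
        50 * (#(Nat.smoothNumbersUpTo ⌊x'⌋₊ (y + 1)) : ℝ) := by linarith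
    calc x' ^ α' * ζt' = x' ^ α' * smoothZeta α' y / Real.sqrt (saddlePhi₂ α' y) := by rw [hζt']; ring
      _ ≤ 50 * (#(Nat.smoothNumbersUpTo ⌊x'⌋₊ (y + 1)) : ℝ) := h1'
      _ ≤ 50 * (C₂ * (x' ^ α * smoothZeta α y / Real.sqrt (saddlePhi₂ α y))) := by linarith
      _ = 50 * C₂ * (x' ^ α * ζt) := by rw [hζt]; ring
  -- the monotonicity steps
  have hlog3 : Real.log x' ^ 3 ≤ Lx ^ 3 := pow_le_pow_left₀ hlogx'0.le hlogx'le 3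
  have hypow : (y : ℝ) ^ (5 / 2 * (1 - α')) ≤ (y : ℝ) ^ (5 / 2 * (1 - α)) :=
    Real.rpow_le_rpow_of_exponent_le hy1 (by linarith)
  have hqLpow : ((q : ℝ) * L') ^ e' ≤ ((q : ℝ) * L') ^ e :=
    Real.rpow_le_rpow_of_exponent_le hqL1 hee'
  calc ‖∑ n ∈ Nat.smoothNumbersUpTo ⌊x'⌋₊ (y + 1), (𝐞 ((n : ℝ) * ((a : ℝ) / q + δ)) : ℂ)‖
      ≤ C_T * Real.log x' ^ 3 * (y : ℝ) ^ (5 / 2 * (1 - α')) * ((q : ℝ) * L') ^ e' * (x' ^ α' * ζt') := h1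
    _ ≤ C_T * Lx ^ 3 * (y : ℝ) ^ (5 / 2 * (1 - α)) * ((q : ℝ) * L') ^ e * (50 * C₂ * (x' ^ α * ζt)) := by
        have h0 : 0 ≤ C_T := hC_T.le
        have hA : C_T * Real.log x' ^ 3 ≤ C_T * Lx ^ 3 := mul_le_mul_of_nonneg_left hlog3 h0
        have hB : 0 ≤ C_T * Real.log x' ^ 3 := by positivity
        have hC : 0 ≤ (y : ℝ) ^ (5 / 2 * (1 - α')) := by positivity
        have hD : 0 ≤ ((q : ℝ) * L') ^ e' := by positivity
        have hE : 0 ≤ x' ^ α' * ζt' := by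
          have : 0 < smoothZeta α' y := smoothZeta_pos hα'0
          positivity
        calc C_T * Real.log x' ^ 3 * (y : ℝ) ^ (5 / 2 * (1 - α')) * ((q : ℝ) * L') ^ e' * (x' ^ α' * ζt')
            ≤ C_T * Lx ^ 3 * (y : ℝ) ^ (5 / 2 * (1 - α)) * ((q : ℝ) * L') ^ e * (x' ^ α' * ζt') := by
              apply mul_le_mul_of_nonneg_right _ hE
              exact mul_le_mul (mul_le_mul hA hypow hC (by positivity)) hqLpow hD (by positivity)
          _ ≤ C_T * Lx ^ 3 * (y : ℝ) ^ (5 / 2 * (1 - α)) * ((q : ℝ) * L') ^ e * (50 * C₂ * (x' ^ α * ζt)) :=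
              mul_le_mul_of_nonneg_left hmodel (by positivity)
    _ = 50 * C_T * C₂ * Lx ^ 3 * (y : ℝ) ^ (5 / 2 * (1 - α)) * ((q : ℝ) * L') ^ e * (x' ^ α * ζt) := by ring
    _ = _ := by rw [he, hζt]

end Literature.NumberTheory.Sieve

end
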